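import Literature.Algebra.Homology.DiscreteRepLayerTransition
import Literature.Algebra.Homology.DiscreteRepProfinite
import HarnessLib

/-!
# Set-up for `Hʳ(Γ, M) = lim→_U Hʳ(Γ⧸U, M^U)` by dimension shifting: an injective presentation
# `0 → M → I → Q → 0` in `C_Γ`, the layer short exact sequences `0 → M^U → I^U → Q'_U → 0`
# (`Q'_U` = classes liftable to `I^U`) and the "liftable to `I^W`" sub-representations of `Q^U`

Topic `Algebra/Homology`; namespace `Literature.Algebra.Homology.DiscreteRep.LayerColimit`.
Definitions with bodies and theorems; no named fact, no `sorry`, no instance.  Sequel of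
`DiscreteRepLayerInflation` / `DiscreteRepLayerTransition` (door-c4 g14: `extInf`, `extInfStep`, the
exact inflation functor `infFunctor`, `invariantsIncl`, δ-compatibility) and `DiscreteRepProfinite`
(g12: over a profinite group every vector is invariant under an open normal subgroup).  Written for
Route A of the Poitou–Tate programme of crux `stmt-BirchSwinnertonDyer-19295` (cell
`bsd-schneider-ideate`, seat door-c4 gen 14), item (d) (FINDING-door-c4-g14 §4; Serre, *Galois
Cohomology* I §2.2 Prop. 8; Harari Prop. 4.18 / Remark 4.24).

For `M ∈ C_Γ` (`Γ` profinite) fix Mathlib's injective presentation `ι : M ↪ I = Injective.under M`,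
`Q = cokernel ι`, `π`:
* §1 `presSC M` (`0 → M → I → Q → 0`, short exact), `presπ_surjective`, `exists_presι_eq_of_presπ_eq_zero`
  (elementwise exactness).
* §2 for open normal `U`, `W`: the sub-`Γ⧸U`-representation **`liftable M U W ⊆ Q^U`** of classes
  having a lift in `I^W` (`liftableSubrep`, `liftableIncl` injective, transitions `liftableMono` for
  `W' ≤ W`, `exists_mem_liftable` — every `q ∈ Q^U` is liftable to some `I^W`, by discreteness of `I`),
  the change of layer `liftableToLayer : layerRes (liftable M U W) ⟶ liftable M W W` for `W ≤ U`
  (`liftableToLayer_comp_incl`).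
* §3 the LAYER SHORT EXACT SEQUENCE **`layerSC M U : 0 → M^U → I^U → liftable M U U → 0`**
  (`layerSC_shortExact`; `I^U` injective by `injective_quotientToInvariants`) and the morphism
  **`layerSCHom M U : (layerSC M U).map Inf ⟶ presSC M`** of short complexes in `C_Γ` (inclusions).

HONEST FRAMING: homological algebra only.

## References
* J.-P. Serre, *Galois Cohomology*, Springer (1997), I §2.2 Proposition 8. [SerreGaloisCohomology1997]
* D. Harari, *Galois Cohomology and Class Field Theory* (2020), §4.3 Prop. 4.18, Remark 4.24 (p. 95).
  [Harari2020]
-/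

noncomputable section

universe u

namespace Literature.Algebra.Homology

namespace DiscreteRep

namespace LayerColimit

open CategoryTheory CategoryTheory.Limits CategoryTheory.Abelian Representation

variable {k Γ : Type u} [CommRing k] [Group Γ] [TopologicalSpace Γ] [IsTopologicalGroup Γ]
  (M : DiscreteRepCat k Γ)

/-! ## §1 The injective presentation `0 → M → I → Q → 0` -/

/-- The injective hull-object `I = Injective.under M` of Mathlib's enough-injectives structure.
[cite: Harari2020, §4.3 Remark 4.24] -/
abbrev pres : DiscreteRepCat k Γ := Injective.under M

/-- `ι : M ↪ I`. [cite: Harari2020, §4.3 Remark 4.24] -/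
abbrev presι : M ⟶ pres M := Injective.ι M

/-- `Q = I / M`. [cite: Harari2020, §4.3 Remark 4.24] -/
abbrev presQ : DiscreteRepCat k Γ := cokernel (presι M)

/-- `π : I ↠ Q`. [cite: Harari2020, §4.3 Remark 4.24] -/
abbrev presπ : pres M ⟶ presQ M := cokernel.π (presι M)

/-- The short complex `M → I → Q`. [cite: Harari2020, §4.3 Remark 4.24] -/
abbrev presSC : ShortComplex (DiscreteRepCat k Γ) :=
  ShortComplex.mk (presι M) (presπ M) (cokernel.condition _)

/-- `0 → M → I → Q → 0` is short exact. [cite: Harari2020, §4.3 Remark 4.24] -/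
theorem presSC_shortExact : (presSC M).ShortExact :=
  { exact := ShortComplex.exact_cokernel (presι M) }

/-- `π` is surjective on vectors. [cite: Harari2020, §4.3 Remark 4.24] -/
theorem presπ_surjective : Function.Surjective (presπ M).hom.hom :=
  (Rep.epi_iff_surjective ((ι k Γ).map (presπ M))).1 inferInstance

/-- `ι` is injective on vectors. [cite: Harari2020, §4.3 Remark 4.24] -/
theorem presι_injective : Function.Injective (presι M).hom.hom :=
  (Rep.mono_iff_injective ((ι k Γ).map (presι M))).1 inferInstance

/-- Elementwise exactness at `I`: a vector killed by `π` comes from `M`.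
[cite: Harari2020, §4.3 Remark 4.24] -/
theorem exists_presι_eq_of_presπ_eq_zero (i : (pres M).obj.V) (hi : (presπ M).hom.hom i = 0) :
    ∃ m : M.obj.V, (presι M).hom.hom m = i := by
  haveI : (ι k Γ).PreservesHomology :=
    ⟨fun _ _ f => (isDiscrete k Γ).preservesKernels_ι f,
      fun _ _ f => (isDiscrete k Γ).preservesCokernels_ι f⟩
  have h := (presSC_shortExact M).exact
  rw [← ShortComplex.exact_map_iff_of_faithful _ (ι k Γ),
    ← ShortComplex.exact_map_iff_of_faithful _ (forget₂ (Rep.{u} k Γ) (ModuleCat.{u} k)),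
    ShortComplex.moduleCat_exact_iff] at h
  obtain ⟨m, hm⟩ := h i hi
  exact ⟨m, hm⟩

/-- `π ∘ ι = 0` on vectors. [cite: Harari2020, §4.3 Remark 4.24] -/
theorem presπ_presι_apply (m : M.obj.V) : (presπ M).hom.hom ((presι M).hom.hom m) = 0 := by
  change ((presι M) ≫ presπ M).hom.hom m = 0
  rw [cokernel.condition]
  rfl

/-! ## §2 Classes of `Q^U` liftable to `I^W` -/

section Liftable

variable (U W : Subgroup Γ) [U.Normal] [W.Normal]

/-- The sub-`Γ⧸U`-representation of `Q^U` of the classes having a lift in `I^W` (stable because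
`W` is normal and `π` is equivariant). [cite: SerreGaloisCohomology1997, I §2.2 Proposition 8] -/
def liftableSubrep : Subrepresentation ((presQ M).obj.quotientToInvariants U).ρ where
  toSubmodule :=
    { carrier := {q | ∃ i : (pres M).obj.V,
        i ∈ invariants ((pres M).obj.ρ.comp W.subtype) ∧ (presπ M).hom.hom i = q.1}
      add_mem' := by
        rintro a b ⟨i, hi, hia⟩ ⟨j, hj, hjb⟩
        exact ⟨i + j, add_mem hi hj, by rw [map_add, hia, hjb]; rfl⟩
      zero_mem' := ⟨0, zero_mem _, by rw [map_zero]; rfl⟩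
      smul_mem' := by
        rintro c a ⟨i, hi, hia⟩
        exact ⟨c • i, Submodule.smul_mem _ c hi, by rw [map_smul, hia]; rfl⟩ }
  apply_mem_toSubmodule g := by
    rintro q ⟨i, hi, hiq⟩
    induction g using QuotientGroup.induction_on with
    | H g =>
      refine ⟨(pres M).obj.ρ g i, fun w => ?_, ?_⟩
      · have hw : (g⁻¹ * (w : Γ) * g) ∈ W := Subgroup.Normal.conj_mem' inferInstance (w : Γ) w.2 g
        have h := hi ⟨g⁻¹ * (w : Γ) * g, hw⟩
        simp only [MonoidHom.coe_comp, Function.comp_apply, Subgroup.coe_subtype] at h ⊢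
        rw [map_mul, map_mul, Module.End.mul_apply, Module.End.mul_apply] at h
        have h' := congrArg ((pres M).obj.ρ g) h
        rwa [← Module.End.mul_apply, ← map_mul, mul_inv_cancel, map_one, Module.End.one_apply] at h'
      · erw [Rep.hom_comm_apply (presπ M).hom g i, hiq]
        rfl

/-- **`liftable M U W ⊆ Q^U`**: the classes of `Q^U` with a lift in `I^W`, as an object of
`Rep k (Γ⧸U)`. [cite: SerreGaloisCohomology1997, I §2.2 Proposition 8] -/
abbrev liftable : Rep.{u} k (Γ ⧸ U) := Rep.of (liftableSubrep M U W).toRepresentation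

/-- Membership in `liftable`. [cite: SerreGaloisCohomology1997, I §2.2 Proposition 8] -/
theorem mem_liftableSubrep_iff (q : ((presQ M).obj.quotientToInvariants U).V) :
    q ∈ (liftableSubrep M U W).toSubmodule ↔
      ∃ i : (pres M).obj.V, i ∈ invariants ((pres M).obj.ρ.comp W.subtype) ∧ (presπ M).hom.hom i = q.1 :=
  Iff.rfl

/-- The inclusion `liftable M U W ⟶ Q^U`. [cite: SerreGaloisCohomology1997, I §2.2 Proposition 8] -/
def liftableIncl : liftable M U W ⟶ (invariantsQuotFunctor k U).obj (presQ M) :=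
  Rep.ofHom ⟨(liftableSubrep M U W).toSubmodule.subtype, fun _ => LinearMap.ext fun _ => rfl⟩

/-- Formula. [cite: SerreGaloisCohomology1997, I §2.2 Proposition 8] -/
@[simp]
theorem liftableIncl_hom_apply (q : (liftableSubrep M U W).toSubmodule) :
    (liftableIncl M U W).hom q = q.1 := rfl

/-- `liftableIncl` is injective. [cite: SerreGaloisCohomology1997, I §2.2 Proposition 8] -/
theorem liftableIncl_injective : Function.Injective (liftableIncl M U W).hom :=
  fun _ _ h => Subtype.ext h

variable {W} in
/-- **Transitions**: `liftable M U W ⟶ liftable M U W'` for `W' ≤ W` (a lift in `I^W` is a lift in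
`I^{W'}`). [cite: SerreGaloisCohomology1997, I §2.2 Proposition 8] -/
def liftableMono {W' : Subgroup Γ} [W'.Normal] (h : W' ≤ W) : liftable M U W ⟶ liftable M U W' :=
  Rep.ofHom
    ⟨{ toFun := fun q => ⟨q.1, by
          obtain ⟨i, hi, hiq⟩ := q.2
          exact ⟨i, fun w => hi ⟨w.1, h w.2⟩, hiq⟩⟩
       map_add' := fun _ _ => rfl
       map_smul' := fun _ _ => rfl },
     fun g => LinearMap.ext fun _ => Subtype.ext rfl⟩

/-- Transitions are compatible with the inclusions into `Q^U`.
[cite: SerreGaloisCohomology1997, I §2.2 Proposition 8] -/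
theorem liftableMono_comp_incl {W' : Subgroup Γ} [W'.Normal] (h : W' ≤ W) :
    liftableMono M U h ≫ liftableIncl M U W' = liftableIncl M U W :=
  Rep.hom_ext (DFunLike.ext _ _ fun _ => rfl)

end Liftable

section Cover

variable [CompactSpace Γ] [TotallyDisconnectedSpace Γ] (U : Subgroup Γ) [U.Normal]

/-- **Every class of `Q^U` is liftable to `I^W` for some open normal `W`** (`π` is onto and every
vector of the discrete `I` is invariant under an open normal subgroup).
[cite: SerreGaloisCohomology1997, I §2.2 Proposition 8][cite: Harari2020, §4.3, proof of Corollary 4.21] -/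
theorem exists_mem_liftable (q : ((presQ M).obj.quotientToInvariants U).V) :
    ∃ W : OpenNormalSubgroup Γ, ∃ q' : (liftableSubrep M U (W : Subgroup Γ)).toSubmodule,
      (liftableIncl M U (W : Subgroup Γ)).hom q' = q := by
  obtain ⟨i, hi⟩ := presπ_surjective M q.1
  obtain ⟨W, hW⟩ := exists_openNormalSubgroup_mem_invariants (pres M) i
  exact ⟨W, ⟨q, i, hW, hi⟩, rfl⟩

end Cover

/-! ## §3 Change of layer for `liftable`, and the layer short exact sequence -/

section Layer

variable (U W : Subgroup Γ) [U.Normal] [W.Normal] (hWU : W ≤ U)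

/-- **Change of layer**: `layerRes (liftable M U W) ⟶ liftable M W W` for `W ≤ U` (a class of `Q^U`
liftable to `I^W` is a class of `Q^W` liftable to `I^W`). [cite: SerreGaloisCohomology1997, I §2.2 Proposition 8] -/
def liftableToLayer : (layerRes k U W hWU).obj (liftable M U W) ⟶ liftable M W W :=
  Rep.ofHom
    ⟨{ toFun := fun q => ⟨⟨q.1.1, mem_invariants_of_le U W hWU (presQ M) q.1⟩, by
          obtain ⟨i, hi, hiq⟩ := q.2
          exact ⟨i, hi, hiq⟩⟩
       map_add' := fun _ _ => rfl
       map_smul' := fun _ _ => rfl },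
     fun g => QuotientGroup.induction_on g fun _ => LinearMap.ext fun _ => Subtype.ext (Subtype.ext rfl)⟩

/-- `liftableToLayer ≫ incl_W = layerRes(incl_U) ≫ (Q^U ⊆ Q^W)`.
[cite: SerreGaloisCohomology1997, I §2.2 Proposition 8] -/
theorem liftableToLayer_comp_incl :
    liftableToLayer M U W hWU ≫ liftableIncl M W W =
      (layerRes k U W hWU).map (liftableIncl M U W) ≫ invariantsStepIncl U W hWU (presQ M) :=
  Rep.hom_ext (DFunLike.ext _ _ fun _ => Subtype.ext rfl)

/-- The projection `I^U ⟶ liftable M U U`, `i ↦ π i`. [cite: SerreGaloisCohomology1997, I §2.2 Proposition 8] -/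
def liftableProj : (invariantsQuotFunctor k U).obj (pres M) ⟶ liftable M U U :=
  Rep.ofHom
    ⟨{ toFun := fun i => ⟨((invariantsQuotFunctor k U).map (presπ M)).hom i, i.1, i.2, rfl⟩
       map_add' := fun _ _ => Subtype.ext (map_add _ _ _)
       map_smul' := fun _ _ => Subtype.ext (map_smul _ _ _) },
     fun g => LinearMap.ext fun i => Subtype.ext
       (Rep.hom_comm_apply ((invariantsQuotFunctor k U).map (presπ M)) g i)⟩

/-- `liftableProj ≫ incl = π^U`. [cite: SerreGaloisCohomology1997, I §2.2 Proposition 8] -/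
theorem liftableProj_comp_incl :
    liftableProj M U ≫ liftableIncl M U U = (invariantsQuotFunctor k U).map (presπ M) :=
  Rep.hom_ext (DFunLike.ext _ _ fun _ => rfl)

/-- `liftableProj` is surjective. [cite: SerreGaloisCohomology1997, I §2.2 Proposition 8] -/
theorem liftableProj_surjective : Function.Surjective (liftableProj M U).hom := by
  rintro ⟨q, i, hi, hiq⟩
  exact ⟨⟨i, hi⟩, Subtype.ext (Subtype.ext hiq)⟩

/-- `ι^U ≫ liftableProj = 0`. [cite: SerreGaloisCohomology1997, I §2.2 Proposition 8] -/
theorem map_presι_comp_liftableProj :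
    (invariantsQuotFunctor k U).map (presι M) ≫ liftableProj M U = 0 :=
  Rep.hom_ext (DFunLike.ext _ _ fun m => Subtype.ext (Subtype.ext (presπ_presι_apply M m.1)))

/-- **The layer short complex `M^U → I^U → liftable M U U`.**
[cite: SerreGaloisCohomology1997, I §2.2 Proposition 8][cite: Harari2020, §4.3 Remark 4.24] -/
abbrev layerSC : ShortComplex (Rep.{u} k (Γ ⧸ U)) :=
  ShortComplex.mk ((invariantsQuotFunctor k U).map (presι M)) (liftableProj M U)
    (map_presι_comp_liftableProj M U)

/-- Exactness in `Rep k G` from an elementwise lifting property (transfer through the faithful exact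
forgetful functor to `ModuleCat k`). [cite: Harari2020, §4.2] -/
theorem rep_exact_of_forall {G : Type u} [Group G] {A B C' : Rep.{u} k G} (f : A ⟶ B) (g : B ⟶ C')
    (w : f ≫ g = 0) (h : ∀ b : B.V, g.hom b = 0 → ∃ a : A.V, f.hom a = b) :
    (ShortComplex.mk f g w).Exact := by
  rw [← ShortComplex.exact_map_iff_of_faithful _ (forget₂ (Rep.{u} k G) (ModuleCat.{u} k)),
    ShortComplex.moduleCat_exact_iff]
  intro x₂ hx₂
  obtain ⟨a, ha⟩ := h x₂ hx₂
  exact ⟨a, ha⟩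

/-- **The layer sequence `0 → M^U → I^U → liftable M U U → 0` is short exact.**
[cite: SerreGaloisCohomology1997, I §2.2 Proposition 8][cite: Harari2020, §4.3 Remark 4.24] -/
theorem layerSC_shortExact : (layerSC M U).ShortExact where
  exact := by
    refine rep_exact_of_forall _ _ _ fun i hi => ?_
    have hi' : (presπ M).hom.hom i.1 = 0 := by
      have := congrArg (fun q : (liftableSubrep M U U).toSubmodule => q.1.1) hi
      exact this
    obtain ⟨m, hm⟩ := exists_presι_eq_of_presπ_eq_zero M i.1 hi'
    refine ⟨⟨m, fun u => presι_injective M ?_⟩, Subtype.ext hm⟩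
    change (presι M).hom.hom (M.obj.ρ (U.subtype u) m) = (presι M).hom.hom m
    rw [Rep.hom_comm_apply, hm]
    exact i.2 u
  mono_f := (Rep.mono_iff_injective _).2 fun x y h =>
    Subtype.ext (presι_injective M (congrArg Subtype.val h))
  epi_g := (Rep.epi_iff_surjective _).2 (liftableProj_surjective M U)

variable (hU : IsOpen (U : Set Γ))

include hU in
/-- `I^U` is injective in `Rep k (Γ⧸U)`. [cite: Harari2020, §4.3 Remark 4.24 (p. 95)] -/
theorem injective_layer_X₂ : Injective (layerSC M U).X₂ := injective_quotientToInvariants U hU (pres M)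

/-- **The morphism of short complexes `(layerSC M U).map Inf ⟶ presSC M`** (the three inclusions
`Inf(M^U) ⊆ M`, `Inf(I^U) ⊆ I`, `Inf(liftable) ⊆ Inf(Q^U) ⊆ Q`).
[cite: SerreGaloisCohomology1997, I §2.2 Proposition 8][cite: Harari2020, §4.3 Remark 4.24] -/
def layerSCHom : (layerSC M U).map (infFunctor k U hU) ⟶ presSC M where
  τ₁ := invariantsIncl U hU M
  τ₂ := invariantsIncl U hU (pres M)
  τ₃ := (infFunctor k U hU).map (liftableIncl M U U) ≫ invariantsIncl U hU (presQ M)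
  comm₁₂ := infFunctor_map_invariantsIncl U hU (presι M)
  comm₂₃ := by
    change (infFunctor k U hU).map (liftableProj M U) ≫
        ((infFunctor k U hU).map (liftableIncl M U U) ≫ invariantsIncl U hU (presQ M)) =
      invariantsIncl U hU (pres M) ≫ presπ M
    rw [← Category.assoc, ← Functor.map_comp, liftableProj_comp_incl,
      infFunctor_map_invariantsIncl]

/-- The third component of `layerSCHom`. [cite: SerreGaloisCohomology1997, I §2.2 Proposition 8] -/
theorem layerSCHom_τ₃ :
    (layerSCHom M U hU).τ₃ =
      (infFunctor k U hU).map (liftableIncl M U U) ≫ invariantsIncl U hU (presQ M) := rfl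

/-- The first component of `layerSCHom`. [cite: SerreGaloisCohomology1997, I §2.2 Proposition 8] -/
theorem layerSCHom_τ₁ : (layerSCHom M U hU).τ₁ = invariantsIncl U hU M := rfl

end Layer

end LayerColimit

end DiscreteRep

end Literature.Algebra.Homology
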